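/-
Copyright (c) 2026. All rights reserved.
Released under Apache 2.0 license as described in the file LICENSE.
-/
import Mathlib
import HarnessLib
import Literature.Analysis.Complex.RoucheTheorem
import Summits.RiemannHypothesis.RiemannHypothesis.Theorems.EarlyAppointmentsRoucheAux
import Summits.RiemannHypothesis.RiemannHypothesis.Theorems.EarlyAppointmentsCombGHelpers

/-!
# Critical point existence via Rouché's theorem

The final step: apply Rouche.existsUnique_zero_of_norm_sub_lt to the function
1 + (z - z₀) * G(z) vs h₀(z) = 1 + (z - z₀) * G(z₀).
-/

open Complex Real Set Filter Topology Metric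
open scoped BigOperators Topology ComplexConjugate

noncomputable section

namespace CriticalPointRouche

/-- The function whose zeros we seek: h(z) = 1 + (z - z₀) * G(z). -/
def h (f : ℂ → ℂ) (z₀ : ℂ) (z : ℂ) : ℂ :=
  1 + (z - z₀) * RoucheAux.G f z₀ z

/-- The difference h - h₀ = (z - z₀) * (G(z) - G(z₀)). -/
theorem h_sub_h₀ {f : ℂ → ℂ} {c z : ℂ} :
    h f c z - RoucheAux.h₀ f c z = (z - c) * (RoucheAux.G f c z - RoucheAux.G f c c) := by
  unfold h RoucheAux.h₀
  ring

/-- h₀ is the unique zero in the closed ball (since h₀ is linear, it has at most one zero). -/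
theorem h₀_unique_zero {f : ℂ → ℂ} {c : ℂ} {r : ℝ} (hG_ne : RoucheAux.G f c c ≠ 0) :
    ∀ v : ℂ, v ∈ closedBall c r → RoucheAux.h₀ f c v = 0 → v = c - 1 / RoucheAux.G f c c := by
  intro v _ hv0
  unfold RoucheAux.h₀ at hv0
  have h1 : (v - c) * RoucheAux.G f c c = -1 := by
    have : 1 + (v - c) * RoucheAux.G f c c = 0 := hv0
    calc (v - c) * RoucheAux.G f c c = (v - c) * RoucheAux.G f c c + 1 - 1 := by ring
      _ = 0 - 1 := by rw [add_comm, this]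
      _ = -1 := by ring
  have h2 : v - c = -1 / RoucheAux.G f c c := by
    field_simp [hG_ne]
    exact h1
  calc v = c + (v - c) := by ring
    _ = c + (-1 / RoucheAux.G f c c) := by rw [h2]
    _ = c - 1 / RoucheAux.G f c c := by ring

end CriticalPointRouche

end
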